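import Summits.Ventures.PercRepro.RankLevelSetRuleQCornerReduction

/-!
# PercRepro — THE ROW `J = 1` AT THE CORNER FOR `q ≤ 8k − 1`, UNIFORMLY IN `k ≥ 11` (p4, gen 29; C-044; paper
proofs/P4-CELL-THREE.md §13.12)

The tree's row-one criterion at the corner (`rhat_whole_of_row_one_corner`) needs
`(q+1)·(C(q+1−k, k) + C(2k−1, k)) ≤ k·C(q+k, k)`.  With `a = q + 1 − k`:
* `a < k` (`rowone_choose_part`): `C(a,k) = 0` and `(q+1)·C(2k−1,k) ≤ k·C(q+k,k)` for every `q ≥ k − 1` by induction on `q`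
  (`C(q+k,k)·(q+k+1) = C(q+k+1,k)·(q+1)`, equality at `q = k − 1`);
* `k ≤ a ≤ 2k − 1`: `C(a,k) ≤ C(2k−1,k)`, `q + 1 < 3k`, and `3^k·C(2k−1,k) ≤ 2^k·C(3k−1,k)` (`three_two_choose`, the
  factors `(2k+j)/(k+j) ≥ 3/2` for `j ≤ k`) with `6·2^k ≤ 3^k` (`k ≥ 5`);
* `2k ≤ a ≤ 7k`: `2·C(2k−1,k) = C(2k,k) ≤ C(a,k)`, `q + 1 ≤ 8k`, and `12·C(a,k) ≤ C(a+2k−1,k)` from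
  `(a+c)^j·C(a,j) ≤ C(a+c,j)·a^j` (`choose_ratio_pow`), `11·(a+2k−1) ≥ 14·a` and `14^k ≥ 12·11^k` (`k ≥ 11`).
**`rhat_whole_of_le_eight_k (q k m) (hk : 11 ≤ k) (hq : q + 1 ≤ 8k) (hm : m + k ≤ q + 1) : phiK (q+k) q ≤ rhat q k m`.**
Axioms standard.
-/

namespace PercRepro

/-- `(q+1)·C(2k−1,k) ≤ k·C(q+k,k)` for every `q ≥ k − 1` (`1 ≤ k`). -/
lemma rowone_choose_part (k : ℕ) (hk : 1 ≤ k) :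
    ∀ q, k - 1 ≤ q → (q + 1) * (2 * k - 1).choose k ≤ k * (q + k).choose k := by
  intro q hq
  induction q, hq using Nat.le_induction with
  | base =>
    rw [show k - 1 + 1 = k by omega, show k - 1 + k = 2 * k - 1 by omega]
  | succ n hn ih =>
    have hc := Nat.choose_mul_succ_eq (n + k) k
    rw [show n + k + 1 - k = n + 1 by omega] at hc
    rw [show n + 1 + k = n + k + 1 by omega]
    have h1 : (n + 1 + 1) * (2 * k - 1).choose k * (n + 1) ≤ k * (n + k + 1).choose k * (n + 1) := by
      calc (n + 1 + 1) * (2 * k - 1).choose k * (n + 1)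
          = (n + 1 + 1) * ((n + 1) * (2 * k - 1).choose k) := by ring
        _ ≤ (n + 1 + 1) * (k * (n + k).choose k) := Nat.mul_le_mul_left _ ih
        _ ≤ (n + k + 1) * (k * (n + k).choose k) := Nat.mul_le_mul_right _ (by omega)
        _ = k * ((n + k).choose k * (n + k + 1)) := by ring
        _ = k * ((n + k + 1).choose k * (n + 1)) := by rw [hc]
        _ = k * (n + k + 1).choose k * (n + 1) := by ring
    exact Nat.le_of_mul_le_mul_right h1 (by omega)

/-- `3^j·C(2k−1,k) ≤ 2^j·C(2k−1+j,k)` for `j ≤ k` (`1 ≤ k`): each step multiplies by `(2k+j)/(k+j) ≥ 3/2`. -/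
lemma three_two_choose (k : ℕ) (hk : 1 ≤ k) :
    ∀ j, j ≤ k → 3 ^ j * (2 * k - 1).choose k ≤ 2 ^ j * (2 * k - 1 + j).choose k := by
  intro j
  induction j with
  | zero => intro _; simp
  | succ j ih =>
    intro hj
    have ih' := ih (by omega)
    have hc := Nat.choose_mul_succ_eq (2 * k - 1 + j) k
    rw [show 2 * k - 1 + j + 1 = 2 * k + j by omega, show 2 * k + j - k = k + j by omega] at hc
    have h1 : 3 ^ (j + 1) * (2 * k - 1).choose k * (k + j) ≤ 2 ^ (j + 1) * (2 * k + j).choose k * (k + j) := by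
      calc 3 ^ (j + 1) * (2 * k - 1).choose k * (k + j)
          = 3 * (3 ^ j * (2 * k - 1).choose k) * (k + j) := by ring
        _ ≤ 3 * (2 ^ j * (2 * k - 1 + j).choose k) * (k + j) :=
            Nat.mul_le_mul_right _ (Nat.mul_le_mul_left _ ih')
        _ = 2 ^ j * (2 * k - 1 + j).choose k * (3 * (k + j)) := by ring
        _ ≤ 2 ^ j * (2 * k - 1 + j).choose k * (2 * (2 * k + j)) :=
            Nat.mul_le_mul_left _ (by omega)
        _ = 2 ^ (j + 1) * ((2 * k - 1 + j).choose k * (2 * k + j)) := by ring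
        _ = 2 ^ (j + 1) * ((2 * k + j).choose k * (k + j)) := by rw [hc]
        _ = 2 ^ (j + 1) * (2 * k + j).choose k * (k + j) := by ring
    rw [show 2 * k - 1 + (j + 1) = 2 * k + j by omega]
    exact Nat.le_of_mul_le_mul_right h1 (by omega)

/-- `6·2^k ≤ 3^k` for `k ≥ 5`. -/
lemma six_two_pow_le (k : ℕ) (hk : 5 ≤ k) : 6 * 2 ^ k ≤ 3 ^ k := by
  induction k, hk using Nat.le_induction with
  | base => norm_num
  | succ n hn ih =>
    rw [pow_succ, pow_succ]
    omega

/-- `14^k ≥ 12·11^k` for `k ≥ 11`. -/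
lemma fourteen_pow_ge (k : ℕ) (hk : 11 ≤ k) : 12 * 11 ^ k ≤ 14 ^ k := by
  induction k, hk using Nat.le_induction with
  | base => norm_num
  | succ n hn ih =>
    rw [pow_succ, pow_succ]
    omega

/-- The factor inequality `(a+c)·(a−j) ≤ (a+c−j)·a` in `ℕ`. -/
lemma factor_ineq (a c j : ℕ) : (a + c) * (a - j) ≤ (a + c - j) * a := by
  rcases le_or_gt j a with h | h
  · obtain ⟨b, rfl⟩ : ∃ b, a = b + j := ⟨a - j, by omega⟩
    rw [show b + j + c - j = b + c by omega, show b + j - j = b by omega]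
    nlinarith
  · rw [Nat.sub_eq_zero_of_le h.le]
    simp

/-- `(a+c)^j·C(a,j) ≤ C(a+c,j)·a^j` (the ratio `C(a+c,j)/C(a,j) = Π_{r<j}(a+c−r)/(a−r) ≥ ((a+c)/a)^j`). -/
lemma choose_ratio_pow (a c : ℕ) : ∀ j, (a + c) ^ j * a.choose j ≤ (a + c).choose j * a ^ j := by
  intro j
  induction j with
  | zero => simp
  | succ j ih =>
    have h1 := Nat.choose_succ_right_eq (a + c) j
    have h2 := Nat.choose_succ_right_eq a j
    -- h1 : (a+c).choose (j+1) * (j+1) = (a+c).choose j * (a+c−j); h2 : a.choose (j+1) * (j+1) = a.choose j * (a−j)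
    have key : (a + c) ^ (j + 1) * a.choose (j + 1) * (j + 1) ≤ (a + c).choose (j + 1) * a ^ (j + 1) * (j + 1) := by
      calc (a + c) ^ (j + 1) * a.choose (j + 1) * (j + 1)
          = (a + c) ^ j * (a + c) * (a.choose (j + 1) * (j + 1)) := by ring
        _ = (a + c) ^ j * (a + c) * (a.choose j * (a - j)) := by rw [h2]
        _ = ((a + c) ^ j * a.choose j) * ((a + c) * (a - j)) := by ring
        _ ≤ ((a + c).choose j * a ^ j) * ((a + c - j) * a) :=
            Nat.mul_le_mul ih (factor_ineq a c j)
        _ = ((a + c).choose j * (a + c - j)) * (a ^ j * a) := by ring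
        _ = ((a + c).choose (j + 1) * (j + 1)) * (a ^ j * a) := by rw [h1]
        _ = (a + c).choose (j + 1) * a ^ (j + 1) * (j + 1) := by ring
    exact Nat.le_of_mul_le_mul_right key (by omega)

/-- `12·C(a,k) ≤ C(a+2k−1,k)` for `2k ≤ a ≤ 7k`, `k ≥ 11`. -/
lemma twelve_choose_le (a k : ℕ) (hk : 11 ≤ k) (ha1 : 2 * k ≤ a) (ha2 : a ≤ 7 * k) :
    12 * a.choose k ≤ (a + (2 * k - 1)).choose k := by
  have hr := choose_ratio_pow a (2 * k - 1) k
  -- 11·(a+2k−1) ≥ 14·a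
  have h11 : 14 * a ≤ 11 * (a + (2 * k - 1)) := by omega
  have hpow : (14 * a) ^ k ≤ (11 * (a + (2 * k - 1))) ^ k := Nat.pow_le_pow_left h11 k
  rw [mul_pow, mul_pow] at hpow
  have h14 := fourteen_pow_ge k hk
  -- 12·a^k·11^k ≤ 14^k·a^k ≤ 11^k·(a+2k−1)^k  ⇒  12·a^k ≤ (a+2k−1)^k
  have h12 : 12 * a ^ k * 11 ^ k ≤ (a + (2 * k - 1)) ^ k * 11 ^ k := by
    calc 12 * a ^ k * 11 ^ k = (12 * 11 ^ k) * a ^ k := by ring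
      _ ≤ 14 ^ k * a ^ k := Nat.mul_le_mul_right _ h14
      _ ≤ 11 ^ k * (a + (2 * k - 1)) ^ k := hpow
      _ = (a + (2 * k - 1)) ^ k * 11 ^ k := by ring
  have h12' : 12 * a ^ k ≤ (a + (2 * k - 1)) ^ k :=
    Nat.le_of_mul_le_mul_right h12 (by positivity)
  have hak : 0 < a ^ k := by
    have : 0 < a := by omega
    positivity
  have key : 12 * a.choose k * a ^ k ≤ (a + (2 * k - 1)).choose k * a ^ k := by
    calc 12 * a.choose k * a ^ k = (12 * a ^ k) * a.choose k := by ring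
      _ ≤ (a + (2 * k - 1)) ^ k * a.choose k := Nat.mul_le_mul_right _ h12'
      _ ≤ (a + (2 * k - 1)).choose k * a ^ k := hr
  exact Nat.le_of_mul_le_mul_right key hak

/-- `2·C(2k−1,k) = C(2k,k)` for `1 ≤ k`. -/
lemma two_choose_eq (k : ℕ) (hk : 1 ≤ k) : 2 * (2 * k - 1).choose k = (2 * k).choose k := by
  obtain ⟨l, rfl⟩ : ∃ l, k = l + 1 := ⟨k - 1, by omega⟩
  rw [show 2 * (l + 1) - 1 = 2 * l + 1 by omega, show 2 * (l + 1) = 2 * l + 1 + 1 by omega,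
    Nat.choose_succ_succ' (2 * l + 1) l, Nat.choose_symm_half l]
  ring

/-- **The row-one inequality at the corner for `k − 1 ≤ q ≤ 8k − 1`, `k ≥ 11`**:
`(q+1)·(C(q+1−k, k) + C(2k−1, k)) ≤ k·C(q+k, k)`. -/
theorem rowone_of_le_eight_k (q k : ℕ) (hk : 11 ≤ k) (hq1 : k ≤ q + 1) (hq2 : q + 1 ≤ 8 * k) :
    (q + 1) * ((q + 1 - k).choose k + (2 * k - 1).choose k) ≤ k * (q + k).choose k := by
  have hpart := rowone_choose_part k (by omega) q (by omega)
  rcases lt_or_ge (q + 1) (2 * k) with hlt | hge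
  · -- `a < k`: the first binomial vanishes
    rw [Nat.choose_eq_zero_of_lt (by omega), zero_add]
    exact hpart
  rcases lt_or_ge (q + 1) (3 * k) with hlt3 | hge3
  · -- `k ≤ a ≤ 2k − 1`
    have hA : (q + 1 - k).choose k ≤ (2 * k - 1).choose k := Nat.choose_le_choose k (by omega)
    have h32 := three_two_choose k (by omega) k le_rfl
    rw [show 2 * k - 1 + k = 3 * k - 1 by omega] at h32
    have h6 := six_two_pow_le k (by omega)
    have hmono : (3 * k - 1).choose k ≤ (q + k).choose k := Nat.choose_le_choose k (by omega)
    -- 6k·C(2k−1,k)·2^k ≤ k·3^k·C(2k−1,k) ≤ k·2^k·C(3k−1,k)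
    have h1 : 6 * k * (2 * k - 1).choose k * 2 ^ k ≤ k * (3 * k - 1).choose k * 2 ^ k := by
      calc 6 * k * (2 * k - 1).choose k * 2 ^ k = k * (2 * k - 1).choose k * (6 * 2 ^ k) := by ring
        _ ≤ k * (2 * k - 1).choose k * 3 ^ k := Nat.mul_le_mul_left _ h6
        _ = k * (3 ^ k * (2 * k - 1).choose k) := by ring
        _ ≤ k * (2 ^ k * (3 * k - 1).choose k) := Nat.mul_le_mul_left _ h32
        _ = k * (3 * k - 1).choose k * 2 ^ k := by ring
    have h2 : 6 * k * (2 * k - 1).choose k ≤ k * (3 * k - 1).choose k :=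
      Nat.le_of_mul_le_mul_right h1 (by positivity)
    calc (q + 1) * ((q + 1 - k).choose k + (2 * k - 1).choose k)
        ≤ (q + 1) * ((2 * k - 1).choose k + (2 * k - 1).choose k) := Nat.mul_le_mul_left _ (by omega)
      _ = (q + 1) * 2 * (2 * k - 1).choose k := by ring
      _ ≤ 6 * k * (2 * k - 1).choose k := Nat.mul_le_mul_right _ (by omega)
      _ ≤ k * (3 * k - 1).choose k := h2
      _ ≤ k * (q + k).choose k := Nat.mul_le_mul_left _ hmono
  · -- `2k ≤ a ≤ 7k`
    set a := q + 1 - k with ha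
    have ha1 : 2 * k ≤ a := by omega
    have ha2 : a ≤ 7 * k := by omega
    have h12 := twelve_choose_le a k hk ha1 ha2
    rw [show a + (2 * k - 1) = q + k by omega] at h12
    have h2c := two_choose_eq k (by omega)
    have hC : (2 * k).choose k ≤ a.choose k := Nat.choose_le_choose k ha1
    have hLHS : 2 * ((q + 1) * (a.choose k + (2 * k - 1).choose k)) ≤ 2 * (k * (q + k).choose k) := by
      calc 2 * ((q + 1) * (a.choose k + (2 * k - 1).choose k))
          = (q + 1) * (2 * a.choose k + 2 * (2 * k - 1).choose k) := by ring
        _ = (q + 1) * (2 * a.choose k + (2 * k).choose k) := by rw [h2c]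
        _ ≤ (q + 1) * (2 * a.choose k + a.choose k) := Nat.mul_le_mul_left _ (by omega)
        _ = (q + 1) * (3 * a.choose k) := by ring
        _ ≤ 8 * k * (3 * a.choose k) := Nat.mul_le_mul_right _ hq2
        _ = 2 * (k * (12 * a.choose k)) := by ring
        _ ≤ 2 * (k * (q + k).choose k) := Nat.mul_le_mul_left _ (Nat.mul_le_mul_left _ h12)
    exact Nat.le_of_mul_le_mul_left hLHS (by norm_num)

/-- **THE WHOLE UNTRUNCATED REGIME FOR `q + 1 ≤ 8k`, UNIFORMLY IN `k ≥ 11`** (through the row `J = 1` at the corner):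
`Φ(q+k, q) ≤ R̂(q, k, m)` for every `m ≤ q + 1 − k`. -/
theorem rhat_whole_of_le_eight_k (q k m : ℕ) (hk : 11 ≤ k) (hq : q + 1 ≤ 8 * k) (hm : m + k ≤ q + 1) :
    phiK (q + k) q ≤ rhat q k m :=
  rhat_whole_of_row_one_corner q k (by omega) (by omega) (rowone_of_le_eight_k q k hk (by omega) hq) m hm

end PercRepro
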